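import Mathlib
import HarnessLib
import Summits.NavierStokesRegularity.NavierStokesRegularity.Theorems.UnthreadedDoorPoloidalLiouvilleOfUnthreadedRigidity
import Summits.NavierStokesRegularity.NavierStokesRegularity.Theorems.UnthreadedDoorAntidynamoWallCentrePathAnalytic

/-!
# Route `UnthreadedDoor` / `ThreadingFlux`, crux `PoloidalLiouville` (stmt-NavierStokesRegularity-1222), antidynamo v2 skeleton (sha16 `4ebf5683127b`),
# WALL `stub_scalarLiouville`: THE RESIDUAL OF «⟨1222⟩ ⟸ ⟨27585⟩» AS ONE BY-NAME DICHOTOMY — constant, or an ACCELERATING Oseen gauge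

Support file (seat leafhand-ns-unthreadeddoor-3 g14, cell decomp-ns), `--supports stmt-NavierStokesRegularity-1222 --as helper`; theorems only.

Composition of `FrameSlot.constant_of_unthreadedRigidity_of_affineGauge` (p833594: ⟨27585⟩ decides every flow of ⟨1222⟩'s class whose Oseen gauge has
an AFFINE frame path) with the tree's `OneInstant.curl_eq_zero_or_exists_analytic_gauge` (a non-irrotational flow of the class has an Oseen gauge with a
REAL-ANALYTIC frame path) and `constantOfIrrotational`:

* ★ `FrameSlot.constant_or_accelerating_gauge_of_unthreadedRigidity` — ASSUMING `UnthreadedRigidity` (stmt-27585, OPEN — a hypothesis): a flow of the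
  wall's class EITHER has spatially constant slices, OR admits an Oseen gauge `v(t,x) = w(t, x − A(t)) + c(t)` (`w` continuous, bounded, weakly
  divergence-free, Oseen-mild, jointly real-analytic) whose frame path `A` is real-analytic at every `t < 0` and NOT AFFINE on `(−∞,0)`.

So, given ⟨27585⟩, what is left of ⟨1222⟩ is precisely the ACCELERATED-FRAME case of `Literature.Barriers.NavierStokesRegularity.GalileanFrameSlot`:
an honest uniformly-accelerating (analytic, non-affine) Galilean gauge.  Removing it needs ⟨27585⟩ for the drift class (its research stub
`StubShearedRigidity` without the Oseen binder), or a centre-freezing theorem; neither is in the tree.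

HONEST LABEL: conditional glue (⟨27585⟩ OPEN, a hypothesis); nothing here proves `stub_scalarLiouville`, `PoloidalLiouville` (1222), `UnthreadedRigidity`
(27585), or bears on Navier–Stokes regularity; no summit statement is proved. [folklore]
[cite: KochNadirashviliSereginSverak2009, §1 p. 3, §4 (i)–(ii), (4.3)–(4.4), Thm 5.2 (arXiv:0709.3599 pp. 3, 8–10); LemarieRieusset2016, Thm. 9.12; Tao2013Localisation, §3]
-/

noncomputable section

-- the summit and its single sub-problem share the name (CONVENTIONS §1)
set_option linter.dupNamespace false

open scoped Topology InnerProductSpace RealInnerProductSpace ContDiff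
open Filter Set Function Metric MeasureTheory
open Literature.Analysis Literature.Analysis.FluidPDE

namespace Summit.NavierStokesRegularity.NavierStokesRegularity.Theorems.PoloidalLiouville.Antidynamo

open Summit.NavierStokesRegularity.NavierStokesRegularity.Theorems.PoloidalLiouville (constantOfIrrotational)

namespace FrameSlot

/-- ★ **CONSTANT, OR AN ACCELERATING OSEEN GAUGE.**  Assume `UnthreadedRigidity` (stmt-27585, OPEN — a hypothesis).  Let `v` be a flow of the wall's class
(bounded ancient duality-mild, `ν = 1`, measurable slices, jointly smooth on `(−∞,0) × ℝ³`, vorticity tangent to the spheres about `x₀`).  Then EITHER every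
slice of `v` is spatially constant, OR `v` has an Oseen gauge `v(t,x) = w(t, x − A(t)) + c(t)` — `w` continuous and uniformly bounded on `(−∞,0) × ℝ³`,
weakly divergence-free slices, Oseen integral identity, jointly real-analytic — whose frame path `A` is real-analytic at every `t < 0` and is NOT affine:
there are no `a, k` with `A(t) = a + t k` for all `t < 0`.  [Irrotational ⇒ constant (`constantOfIrrotational`); else the analytic gauge of
`OneInstant.curl_eq_zero_or_exists_analytic_gauge`; if its frame path were affine, `constant_of_unthreadedRigidity_of_affineGauge` (p833594).]
[cite: KochNadirashviliSereginSverak2009, §1 p. 3, §4 (i)–(ii), Thm 5.2 (arXiv:0709.3599 pp. 3, 8–10); LemarieRieusset2016, Thm. 9.12] -/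
theorem constant_or_accelerating_gauge_of_unthreadedRigidity
    (h27585 : Summit.NavierStokesRegularity.NavierStokesRegularity.Theses.UnthreadedRigidityDoor.UnthreadedRigidity)
    (v : ℝ → EuclideanSpace ℝ (Fin 3) → EuclideanSpace ℝ (Fin 3)) (x₀ : EuclideanSpace ℝ (Fin 3))
    (hB : Literature.Analysis.FluidPDE.IsBoundedAncientMildSolution 1 v)
    (hm : ∀ t < 0, AEStronglyMeasurable (v t) volume)
    (hsm : ContDiffOn ℝ (⊤ : ℕ∞) (Function.uncurry v) (Set.Iio 0 ×ˢ Set.univ))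
    (hun : ∀ t < 0, ∀ x, ⟪x - x₀, curl (v t) x⟫ = 0) :
    (∀ t < 0, ∃ b : EuclideanSpace ℝ (Fin 3), ∀ x, v t x = b) ∨
      ∃ (w : ℝ → EuclideanSpace ℝ (Fin 3) → EuclideanSpace ℝ (Fin 3)) (A c : ℝ → EuclideanSpace ℝ (Fin 3)),
        ContinuousOn (Function.uncurry w) (Set.Iio 0 ×ˢ Set.univ) ∧
        (∃ K : ℝ, ∀ t < 0, ∀ y, ‖w t y‖ ≤ K) ∧
        (∀ t < 0, IsWeaklyDivFree (w t)) ∧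
        (∀ s t : ℝ, s < t → t < 0 → ∀ y,
          w t y = UnboundedOperators.heatExtension (w s) (t - s) y - oseenDuhamel 1 s w w t y) ∧
        AnalyticOnNhd ℝ (Function.uncurry w) (Set.Iio (0 : ℝ) ×ˢ (Set.univ : Set (EuclideanSpace ℝ (Fin 3)))) ∧
        (∀ t < 0, ∀ x, v t x = w t (x - A t) + c t) ∧
        (∀ t < 0, AnalyticAt ℝ A t) ∧
        ¬ ∃ a k : EuclideanSpace ℝ (Fin 3), ∀ t < 0, A t = a + t • k := by
  rcases OneInstant.curl_eq_zero_or_exists_analytic_gauge v x₀ hB hm hsm hun with h0 |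
    ⟨w, A, c, hwc, hwb, hwdiv, hwmild, hwA, hrep, hAan⟩
  · exact Or.inl (constantOfIrrotational v hB hsm h0)
  by_cases haff : ∃ a k : EuclideanSpace ℝ (Fin 3), ∀ t < 0, A t = a + t • k
  · obtain ⟨a, k, hak⟩ := haff
    refine Or.inl (constant_of_unthreadedRigidity_of_affineGauge h27585 v x₀ hB hm hsm hun w a k c hwc hwb hwdiv
      hwmild fun t ht x => ?_)
    rw [← hak t ht]
    exact hrep t ht x
  · exact Or.inr ⟨w, A, c, hwc, hwb, hwdiv, hwmild, hwA, hrep, hAan, haff⟩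

/-- **The same dichotomy at the level of the vorticity** (the wall's currency): assuming `UnthreadedRigidity`, a flow of the wall's class is EITHER
irrotational at all negative times, OR has an accelerating (real-analytic, non-affine frame path) Oseen gauge as above.
[cite: KochNadirashviliSereginSverak2009, §4 (i)–(ii), Thm 5.2 (arXiv:0709.3599 pp. 8–10); LemarieRieusset2016, Thm. 9.12] -/
theorem curl_eq_zero_or_accelerating_gauge_of_unthreadedRigidity
    (h27585 : Summit.NavierStokesRegularity.NavierStokesRegularity.Theses.UnthreadedRigidityDoor.UnthreadedRigidity)
    (v : ℝ → EuclideanSpace ℝ (Fin 3) → EuclideanSpace ℝ (Fin 3)) (x₀ : EuclideanSpace ℝ (Fin 3))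
    (hB : Literature.Analysis.FluidPDE.IsBoundedAncientMildSolution 1 v)
    (hm : ∀ t < 0, AEStronglyMeasurable (v t) volume)
    (hsm : ContDiffOn ℝ (⊤ : ℕ∞) (Function.uncurry v) (Set.Iio 0 ×ˢ Set.univ))
    (hun : ∀ t < 0, ∀ x, ⟪x - x₀, curl (v t) x⟫ = 0) :
    (∀ t < 0, ∀ x, curl (v t) x = 0) ∨
      ∃ (w : ℝ → EuclideanSpace ℝ (Fin 3) → EuclideanSpace ℝ (Fin 3)) (A c : ℝ → EuclideanSpace ℝ (Fin 3)),
        ContinuousOn (Function.uncurry w) (Set.Iio 0 ×ˢ Set.univ) ∧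
        (∃ K : ℝ, ∀ t < 0, ∀ y, ‖w t y‖ ≤ K) ∧
        (∀ t < 0, IsWeaklyDivFree (w t)) ∧
        (∀ s t : ℝ, s < t → t < 0 → ∀ y,
          w t y = UnboundedOperators.heatExtension (w s) (t - s) y - oseenDuhamel 1 s w w t y) ∧
        AnalyticOnNhd ℝ (Function.uncurry w) (Set.Iio (0 : ℝ) ×ˢ (Set.univ : Set (EuclideanSpace ℝ (Fin 3)))) ∧
        (∀ t < 0, ∀ x, v t x = w t (x - A t) + c t) ∧
        (∀ t < 0, AnalyticAt ℝ A t) ∧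
        ¬ ∃ a k : EuclideanSpace ℝ (Fin 3), ∀ t < 0, A t = a + t • k := by
  rcases constant_or_accelerating_gauge_of_unthreadedRigidity h27585 v x₀ hB hm hsm hun with hc | hacc
  · refine Or.inl fun t ht x => ?_
    obtain ⟨b, hb⟩ := hc t ht
    have hvt : v t = fun _ => b := funext hb
    rw [hvt, curl_eq_curlCLM, fderiv_const_apply, map_zero]
  · exact Or.inr hacc

end FrameSlot

end Summit.NavierStokesRegularity.NavierStokesRegularity.Theorems.PoloidalLiouville.Antidynamo

end
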